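import Literature.MathematicalPhysics.KineticTheory.ReyBelletThomas2002ExpBound
import HarnessLib

/-!
# The Kolmogorov forward equation, in distributional form, for a `MarkovSemigroupFor L`

Trunk T-KINETIC (Literature/MathematicalPhysics/KineticTheory). Inline decomposition step for the
named fact `ReyBelletThomas2002_thm21` (provefact unit), first input of the "`C^∞` law" clause of
Rey-Bellet–Thomas 2002, Thm 2.1 (§4 p. 26: the law solves the Fokker–Planck equation, to which
Hörmander's theorem for `∂_t - L` is applied). For the interface `MarkovSemigroupFor L` (Markov
kernels `P_t`, Chapman–Kolmogorov, Dynkin's identity `P_t f - f = ∫₀ᵗ P_s(Lf) ds` on `C_c^∞`) on a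
normed space `X`, and an operator `L` acting smoothly on smooth compactly supported one-parameter
families (`(t, y) ↦ L(Ψ(t, ·))(y)` is again `C_c^∞` on `ℝ × X` whenever `Ψ` is — true for every
linear differential operator with smooth coefficients), we PROVE:

* `act_sub_act_eq_integral`, `abs_act_sub_act_le` — `P_a h - P_b h = ∫_b^a P_r(Lh) dr`, so
  `t ↦ P_t h(x)` is Lipschitz for `h ∈ C_c^∞`;
* `hasDerivAt_act_family` — for `Ψ ∈ C_c^∞(ℝ × X)` and `t > 0`,
  `d/dt ∫ Ψ(t, y) P_t(x, dy) = ∫ (∂_tΨ + L_yΨ)(t, y) P_t(x, dy)`;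
* `forwardEquation` — **the forward (Fokker–Planck) equation in `𝓓'((0,∞) × X)`**: for every
  `x` and every `Ψ ∈ C_c^∞(ℝ × X)` supported in `(0, ∞) × X`,
  `∫_0^∞ ∫ (∂_tΨ + L_yΨ)(t, y) P_t(x, dy) dt = 0`.

## References

* L. Rey-Bellet, L. E. Thomas, Comm. Math. Phys. 225 (2002) 305–329, §2 (semigroup `T^t`,
  generator `L`), §4. [cite: ReyBelletThomas2002, §4]
* A. N. Kolmogorov, Math. Ann. 104 (1931) 415–458, §13 (the forward equation). [folklore]
-/

noncomputable section

open MeasureTheory ProbabilityTheory Filter Topology Set intervalIntegral Asymptotics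
open scoped NNReal ENNReal ContDiff

namespace Literature.MathematicalPhysics.KineticTheory.HeatConduction

namespace MarkovSemigroupFor

variable {X : Type*} [MeasurableSpace X] [NormedAddCommGroup X] [NormedSpace ℝ X]
  [OpensMeasurableSpace X] {L : (X → ℝ) → X → ℝ} (S : MarkovSemigroupFor L)

/-! ### `t ↦ P_t h(x)` is Lipschitz for `h ∈ C_c^∞` -/

/-- `P_a h(z) - P_b h(z) = ∫_b^a P_r(Lh)(z) dr` for `h ∈ C_c^∞` with `L h` continuous and bounded
(two Dynkin identities). [folklore] -/
theorem act_sub_act_eq_integral {h : X → ℝ} (hh : ContDiff ℝ ∞ h) (hhc : HasCompactSupport h)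
    (hLh : Continuous (L h)) {C : ℝ} (hC : ∀ y, ‖L h y‖ ≤ C) (a b : ℝ≥0) (z : X) :
    S.act a h z - S.act b h z = ∫ r in (b : ℝ)..(a : ℝ), S.act r.toNNReal (L h) z := by
  have ha := S.act_sub_self h hh hhc a z
  have hb := S.act_sub_self h hh hhc b z
  have hmeas : StronglyMeasurable fun r : ℝ => S.act r.toNNReal (L h) z :=
    (S.stronglyMeasurable_uncurry_act hLh.stronglyMeasurable).comp_measurable
      (measurable_const.prodMk measurable_id)
  have hint : ∀ c d : ℝ, IntervalIntegrable (fun r : ℝ => S.act r.toNNReal (L h) z) volume c d :=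
    intervalIntegrable_of_norm_le hmeas fun r => S.norm_act_le _ hC z
  rw [← integral_interval_sub_left (hint 0 a) (hint 0 b)]
  linarith

/-- **`t ↦ P_t h(z)` is Lipschitz for `h ∈ C_c^∞`**: `|P_a h(z) - P_b h(z)| ≤ C |a - b|` with `C`
any bound of `|L h|`. [folklore] -/
theorem abs_act_sub_act_le {h : X → ℝ} (hh : ContDiff ℝ ∞ h) (hhc : HasCompactSupport h)
    (hLh : Continuous (L h)) {C : ℝ} (hC : ∀ y, ‖L h y‖ ≤ C) (a b : ℝ≥0) (z : X) :
    |S.act a h z - S.act b h z| ≤ C * |(a : ℝ) - b| := by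
  rw [S.act_sub_act_eq_integral hh hhc hLh hC a b z, ← Real.norm_eq_abs]
  exact norm_integral_le_of_norm_le_const fun r _ => S.norm_act_le _ hC z

end MarkovSemigroupFor

/-! ### Smooth one-parameter families of test functions -/

section Family

variable {X : Type*} [NormedAddCommGroup X] [NormedSpace ℝ X] {Ψ : ℝ × X → ℝ}

/-- The time derivative `∂_tΨ(t, y) = DΨ(t, y)·(1, 0)` of a smooth family is smooth. [folklore] -/
theorem contDiff_timeDeriv (hΨ : ContDiff ℝ ∞ Ψ) :
    ContDiff ℝ ∞ fun p : ℝ × X => fderiv ℝ Ψ p (1, 0) :=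
  (hΨ.fderiv_right (m := ∞) (by exact_mod_cast le_top)).clm_apply contDiff_const

/-- `∂_tΨ` has compact support if `Ψ` has. [folklore] -/
theorem hasCompactSupport_timeDeriv (hΨc : HasCompactSupport Ψ) :
    HasCompactSupport fun p : ℝ × X => fderiv ℝ Ψ p (1, 0) :=
  HasCompactSupport.fderiv_apply (𝕜 := ℝ) hΨc (1, 0)

/-- The slice `σ ↦ Ψ(σ, y)` has derivative `∂_tΨ(σ, y)`. [folklore] -/
theorem hasDerivAt_timeSlice (hΨ : ContDiff ℝ ∞ Ψ) (y : X) (τ : ℝ) :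
    HasDerivAt (fun σ : ℝ => Ψ (σ, y)) (fderiv ℝ Ψ (τ, y) (1, 0)) τ := by
  have hd : DifferentiableAt ℝ Ψ (τ, y) := (hΨ.differentiable (by simp)) _
  have h1 : HasDerivAt (fun σ : ℝ => ((σ, y) : ℝ × X)) ((1, 0) : ℝ × X) τ :=
    (hasDerivAt_id τ).prodMk (hasDerivAt_const τ y)
  exact hd.hasFDerivAt.comp_hasDerivAt τ h1

/-- The slice `y ↦ Ψ(t, y)` is smooth. [folklore] -/
theorem contDiff_spaceSlice (hΨ : ContDiff ℝ ∞ Ψ) (t : ℝ) : ContDiff ℝ ∞ fun y : X => Ψ (t, y) :=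
  hΨ.comp (contDiff_const.prodMk contDiff_id)

omit [NormedSpace ℝ X] in
/-- The slice `y ↦ Ψ(t, y)` has compact support. [folklore] -/
theorem hasCompactSupport_spaceSlice (hΨc : HasCompactSupport Ψ) (t : ℝ) :
    HasCompactSupport fun y : X => Ψ (t, y) := by
  refine HasCompactSupport.intro (hΨc.image continuous_snd) fun y hy => ?_
  refine image_eq_zero_of_notMem_tsupport fun hmem => hy ⟨(t, y), hmem, rfl⟩

omit [NormedSpace ℝ X] in
/-- A continuous compactly supported function on `ℝ × X` is bounded. [folklore] -/
theorem exists_bound_of_hasCompactSupport' {g : ℝ × X → ℝ} (hg : Continuous g)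
    (hgc : HasCompactSupport g) : ∃ C, 0 ≤ C ∧ ∀ p, ‖g p‖ ≤ C := by
  obtain ⟨C, hC⟩ := hg.bounded_above_of_compact_support hgc
  exact ⟨max C 0, le_max_right _ _, fun p => (hC p).trans (le_max_left _ _)⟩

/-- **Uniform Lipschitz bound in time**: `|g(s,y) - g(t,y)| ≤ M₁ |s - t|` with `M₁` a bound of
`∂_t g`, uniformly in `y`. [folklore] -/
theorem abs_sub_timeSlice_le {g : ℝ × X → ℝ} (hg : ContDiff ℝ ∞ g) {M₁ : ℝ}
    (hM₁ : ∀ p : ℝ × X, ‖fderiv ℝ g p (1, 0)‖ ≤ M₁) (s t : ℝ) (y : X) :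
    |g (s, y) - g (t, y)| ≤ M₁ * |s - t| := by
  have hder : ∀ r ∈ (univ : Set ℝ), HasDerivWithinAt (fun r : ℝ => g (r, y))
      (fderiv ℝ g (r, y) (1, 0)) univ r := fun r _ => (hasDerivAt_timeSlice hg y r).hasDerivWithinAt
  have h := Convex.norm_image_sub_le_of_norm_hasDerivWithin_le hder (fun r _ => hM₁ (r, y))
    convex_univ (mem_univ t) (mem_univ s)
  rwa [Real.norm_eq_abs, Real.norm_eq_abs] at h

/-- **Uniform first-order Taylor bound in time**: `|Ψ(s,y) - Ψ(t,y) - (s-t)∂_tΨ(t,y)| ≤ M₂ (s-t)²`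
with `M₂` a bound of `∂_t²Ψ`, uniformly in `y`. [folklore] -/
theorem abs_sub_sub_mul_timeDeriv_le (hΨ : ContDiff ℝ ∞ Ψ) {M₂ : ℝ}
    (hM₂ : ∀ p : ℝ × X, ‖fderiv ℝ (fun q : ℝ × X => fderiv ℝ Ψ q (1, 0)) p (1, 0)‖ ≤ M₂)
    (s t : ℝ) (y : X) :
    |Ψ (s, y) - Ψ (t, y) - (s - t) * fderiv ℝ Ψ (t, y) (1, 0)| ≤ M₂ * (s - t) ^ 2 := by
  set dΨ : ℝ × X → ℝ := fun q => fderiv ℝ Ψ q (1, 0) with hdΨ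
  have hdΨs : ContDiff ℝ ∞ dΨ := contDiff_timeDeriv hΨ
  have hM₂0 : 0 ≤ M₂ := (norm_nonneg _).trans (hM₂ (t, y))
  set φ : ℝ → ℝ := fun σ => Ψ (σ, y) - σ * dΨ (t, y) with hφ
  have hφd : ∀ σ, HasDerivAt φ (dΨ (σ, y) - dΨ (t, y)) σ := fun σ => by
    have h1 := hasDerivAt_timeSlice hΨ y σ
    have h2 : HasDerivAt (fun σ : ℝ => σ * dΨ (t, y)) (dΨ (t, y)) σ := by
      simpa using (hasDerivAt_id σ).mul_const (dΨ (t, y))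
    exact h1.sub h2
  have hlip : ∀ σ, |dΨ (σ, y) - dΨ (t, y)| ≤ M₂ * |σ - t| := fun σ =>
    abs_sub_timeSlice_le hdΨs hM₂ σ t y
  have hbound : ∀ σ ∈ uIcc t s, ‖dΨ (σ, y) - dΨ (t, y)‖ ≤ M₂ * |s - t| := by
    intro σ hσ
    rw [Real.norm_eq_abs]
    exact (hlip σ).trans (mul_le_mul_of_nonneg_left (abs_sub_left_of_mem_uIcc hσ) hM₂0)
  have h := Convex.norm_image_sub_le_of_norm_hasDerivWithin_le (fun σ _ => (hφd σ).hasDerivWithinAt)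
    hbound (convex_uIcc t s) left_mem_uIcc right_mem_uIcc
  have e : φ s - φ t = Ψ (s, y) - Ψ (t, y) - (s - t) * dΨ (t, y) := by rw [hφ]; ring
  rw [e, Real.norm_eq_abs, Real.norm_eq_abs] at h
  calc |Ψ (s, y) - Ψ (t, y) - (s - t) * dΨ (t, y)| ≤ M₂ * |s - t| * |s - t| := h
    _ = M₂ * (s - t) ^ 2 := by rw [mul_assoc, abs_mul_abs_self]; ring

omit [NormedSpace ℝ X] in
/-- A compactly supported function on `ℝ × X` which does not depend on `t` vanishes. [folklore] -/
theorem eq_zero_of_hasCompactSupport_of_forall_eq {g : ℝ × X → ℝ} (hgc : HasCompactSupport g)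
    {c : X → ℝ} (hg : ∀ t y, g (t, y) = c y) (y : X) : c y = 0 := by
  obtain ⟨R, hR⟩ := hgc.isCompact.isBounded.subset_closedBall (0 : ℝ × X)
  by_contra hne
  have hmem : ((R + 1 : ℝ), y) ∈ tsupport g := subset_tsupport _ (by
    rw [Function.mem_support, hg]; exact hne)
  have h1 := hR hmem
  rw [Metric.mem_closedBall, dist_zero_right, Prod.norm_def] at h1
  have h2 : ‖(R + 1 : ℝ)‖ ≤ R := (le_max_left _ _).trans h1
  rw [Real.norm_eq_abs] at h2
  linarith [le_abs_self (R + 1)]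

end Family

/-! ### The forward equation -/

namespace MarkovSemigroupFor

variable {X : Type*} [MeasurableSpace X] [NormedAddCommGroup X] [NormedSpace ℝ X]
  [OpensMeasurableSpace X] {L : (X → ℝ) → X → ℝ} (S : MarkovSemigroupFor L)
  (hL : ∀ Ψ : ℝ × X → ℝ, ContDiff ℝ ∞ Ψ → HasCompactSupport Ψ →
    ContDiff ℝ ∞ (fun p : ℝ × X => L (fun y => Ψ (p.1, y)) p.2) ∧
    HasCompactSupport (fun p : ℝ × X => L (fun y => Ψ (p.1, y)) p.2))
include hL

omit [MeasurableSpace X] [OpensMeasurableSpace X] S in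
/-- An operator acting smoothly on smooth compactly supported families annihilates `0`. [folklore] -/
theorem apply_zero_eq_zero (y : X) : L (fun _ => (0 : ℝ)) y = 0 := by
  obtain ⟨-, hc⟩ := hL (fun _ => 0) contDiff_const (by
    exact (HasCompactSupport.zero : HasCompactSupport (0 : ℝ × X → ℝ)))
  exact eq_zero_of_hasCompactSupport_of_forall_eq hc (c := fun y => L (fun _ => (0 : ℝ)) y)
    (fun _ _ => rfl) y

/-- **The orbit of a smooth family is differentiable in time**: for `Ψ ∈ C_c^∞(ℝ × X)` and `t > 0`,
`d/dt ∫ Ψ(t, y) P_t(x, dy) = ∫ (∂_tΨ(t, y) + L(Ψ(t, ·))(y)) P_t(x, dy)` — the time dependence of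
the test function contributes `∂_tΨ` (uniform Taylor bound), the motion of the kernel contributes
`L_yΨ` (Dynkin's identity and the Lipschitz continuity of `r ↦ P_r(LΨ(t,·))`). [folklore] -/
theorem hasDerivAt_act_family {Ψ : ℝ × X → ℝ} (hΨ : ContDiff ℝ ∞ Ψ) (hΨc : HasCompactSupport Ψ)
    (x : X) {t : ℝ} (ht : 0 < t) :
    HasDerivAt (fun s : ℝ => S.act s.toNNReal (fun y => Ψ (s, y)) x)
      (S.act t.toNNReal (fun y => fderiv ℝ Ψ (t, y) (1, 0) + L (fun y' => Ψ (t, y')) y) x) t := by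
  -- the families `∂_tΨ`, `LΨ`, and their bounds
  set dΨ : ℝ × X → ℝ := fun q => fderiv ℝ Ψ q (1, 0) with hdΨ
  have hdΨs : ContDiff ℝ ∞ dΨ := contDiff_timeDeriv hΨ
  have hdΨc : HasCompactSupport dΨ := hasCompactSupport_timeDeriv hΨc
  set LΨ : ℝ × X → ℝ := fun p => L (fun y => Ψ (p.1, y)) p.2 with hLΨ
  obtain ⟨hLΨs, hLΨc⟩ := hL Ψ hΨ hΨc
  obtain ⟨hLdΨs, hLdΨc⟩ := hL dΨ hdΨs hdΨc
  obtain ⟨hLLΨs, hLLΨc⟩ := hL LΨ hLΨs hLΨc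
  obtain ⟨M₂, -, hM₂⟩ := exists_bound_of_hasCompactSupport' (contDiff_timeDeriv hdΨs).continuous
    (hasCompactSupport_timeDeriv hdΨc)
  obtain ⟨C_B, hC_B0, hC_B⟩ := exists_bound_of_hasCompactSupport' hLdΨs.continuous hLdΨc
  obtain ⟨C_D, hC_D0, hC_D⟩ := exists_bound_of_hasCompactSupport' hLLΨs.continuous hLLΨc
  obtain ⟨CΨ, -, hCΨ⟩ := exists_bound_of_hasCompactSupport' hΨ.continuous hΨc
  obtain ⟨CdΨ, -, hCdΨ⟩ := exists_bound_of_hasCompactSupport' hdΨs.continuous hdΨc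
  obtain ⟨CLΨ, -, hCLΨ⟩ := exists_bound_of_hasCompactSupport' hLΨs.continuous hLΨc
  -- slices at the base time `t`
  set ψt : X → ℝ := fun y => Ψ (t, y) with hψt
  set dψt : X → ℝ := fun y => dΨ (t, y) with hdψt
  set Lψt : X → ℝ := fun y => LΨ (t, y) with hLψt
  have hψt_s : ContDiff ℝ ∞ ψt := contDiff_spaceSlice hΨ t
  have hψt_c : HasCompactSupport ψt := hasCompactSupport_spaceSlice hΨc t
  have hdψt_s : ContDiff ℝ ∞ dψt := contDiff_spaceSlice hdΨs t
  have hdψt_c : HasCompactSupport dψt := hasCompactSupport_spaceSlice hdΨc t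
  have hLψt_s : ContDiff ℝ ∞ Lψt := contDiff_spaceSlice hLΨs t
  have hLψt_c : HasCompactSupport Lψt := hasCompactSupport_spaceSlice hLΨc t
  -- `L` of the slices are the slices of the `L`-families
  have hL_ψt : L ψt = Lψt := rfl
  have hL_dψt : L dψt = fun y => L (fun y' => dΨ (t, y')) y := rfl
  have hL_Lψt : L Lψt = fun y => L (fun y' => LΨ (t, y')) y := rfl
  have hLdψt_cont : Continuous (L dψt) := hLdΨs.continuous.comp (Continuous.prodMk_right t)
  have hLLψt_cont : Continuous (L Lψt) := hLLΨs.continuous.comp (Continuous.prodMk_right t)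
  have hLψt_cont : Continuous Lψt := hLψt_s.continuous
  have hLdψt_bd : ∀ y, ‖L dψt y‖ ≤ C_B := fun y => hC_B (t, y)
  have hLLψt_bd : ∀ y, ‖L Lψt y‖ ≤ C_D := fun y => hC_D (t, y)
  -- the estimate `|F s - F t - (s - t) G t| ≤ K (s - t)²` for `s > 0`
  set K : ℝ := M₂ + C_B + C_D with hK
  have hkey : ∀ s : ℝ, 0 < s →
      |S.act s.toNNReal (fun y => Ψ (s, y)) x - S.act t.toNNReal ψt x -
        (s - t) * S.act t.toNNReal (fun y => dψt y + Lψt y) x| ≤ K * (s - t) ^ 2 := by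
    intro s hs
    set a : ℝ≥0 := s.toNNReal with ha
    set b : ℝ≥0 := t.toNNReal with hb
    have hac : ((a : ℝ≥0) : ℝ) = s := Real.coe_toNNReal _ hs.le
    have hbc : ((b : ℝ≥0) : ℝ) = t := Real.coe_toNNReal _ ht.le
    -- integrability of the bounded continuous slices
    have iψs : Integrable (fun y => Ψ (s, y)) (S.kernel a x) :=
      S.integrable_kernel_of_norm_le a x (contDiff_spaceSlice hΨ s).continuous fun y => hCΨ (s, y)
    have iψt : ∀ c : ℝ≥0, Integrable ψt (S.kernel c x) := fun c =>
      S.integrable_kernel_of_norm_le c x hψt_s.continuous fun y => hCΨ (t, y)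
    have idψt : ∀ c : ℝ≥0, Integrable dψt (S.kernel c x) := fun c =>
      S.integrable_kernel_of_norm_le c x hdψt_s.continuous fun y => hCdΨ (t, y)
    have iLψt : ∀ c : ℝ≥0, Integrable Lψt (S.kernel c x) := fun c =>
      S.integrable_kernel_of_norm_le c x hLψt_cont fun y => hCLΨ (t, y)
    -- term A: the Taylor remainder in time, integrated against `P_s`
    have hA : |∫ y, (Ψ (s, y) - ψt y - (s - t) * dψt y) ∂(S.kernel a x)| ≤ M₂ * (s - t) ^ 2 := by
      rw [← Real.norm_eq_abs]
      calc ‖∫ y, (Ψ (s, y) - ψt y - (s - t) * dψt y) ∂(S.kernel a x)‖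
          ≤ M₂ * (s - t) ^ 2 * (S.kernel a x).real univ :=
            norm_integral_le_of_norm_le_const (Eventually.of_forall fun y => by
              rw [Real.norm_eq_abs]; exact abs_sub_sub_mul_timeDeriv_le hΨ hM₂ s t y)
        _ = M₂ * (s - t) ^ 2 := by simp
    -- term B: `(s - t)(P_s - P_t) ∂_tΨ(t, ·)`
    have hB : |(s - t) * (S.act a dψt x - S.act b dψt x)| ≤ C_B * (s - t) ^ 2 := by
      rw [abs_mul]
      have h1 := S.abs_act_sub_act_le hdψt_s hdψt_c hLdψt_cont hLdψt_bd a b x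
      rw [hac, hbc] at h1
      calc |s - t| * |S.act a dψt x - S.act b dψt x| ≤ |s - t| * (C_B * |s - t|) :=
            mul_le_mul_of_nonneg_left h1 (abs_nonneg _)
        _ = C_B * (s - t) ^ 2 := by rw [mul_comm, mul_assoc, abs_mul_abs_self]; ring
    -- term D: `(P_s - P_t)Ψ(t,·) - (s - t) P_t(LΨ(t,·)) = ∫_t^s (P_r - P_t)(LΨ(t,·)) dr`
    have hD : |S.act a ψt x - S.act b ψt x - (s - t) * S.act b Lψt x| ≤ C_D * (s - t) ^ 2 := by
      have h1 := S.act_sub_act_eq_integral hψt_s hψt_c hLψt_cont (fun y => hCLΨ (t, y)) a b x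
      rw [hac, hbc, hL_ψt] at h1
      have h2 : (s - t) * S.act b Lψt x = ∫ _r in t..s, S.act b Lψt x := by
        rw [intervalIntegral.integral_const, smul_eq_mul]
      have hmeas : StronglyMeasurable fun r : ℝ => S.act r.toNNReal Lψt x :=
        (S.stronglyMeasurable_uncurry_act hLψt_cont.stronglyMeasurable).comp_measurable
          (measurable_const.prodMk measurable_id)
      have hint : IntervalIntegrable (fun r : ℝ => S.act r.toNNReal Lψt x) volume t s :=
        intervalIntegrable_of_norm_le hmeas (fun r => S.norm_act_le _ (fun y => hCLΨ (t, y)) x) t s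
      rw [h1, h2, ← intervalIntegral.integral_sub hint intervalIntegrable_const, ← Real.norm_eq_abs]
      have h3 : ∀ r ∈ uIoc t s, ‖S.act r.toNNReal Lψt x - S.act b Lψt x‖ ≤ C_D * |s - t| := by
        intro r hr
        have hr0 : 0 < r := by
          rcases le_total t s with hts | hts
          · rw [uIoc_of_le hts] at hr; exact ht.trans hr.1
          · rw [uIoc_of_ge hts] at hr; exact hs.trans hr.1
        have h4 := S.abs_act_sub_act_le hLψt_s hLψt_c hLLψt_cont hLLψt_bd r.toNNReal b x
        rw [Real.coe_toNNReal _ hr0.le, hbc] at h4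
        rw [Real.norm_eq_abs]
        refine h4.trans (mul_le_mul_of_nonneg_left ?_ hC_D0)
        rcases le_total t s with hts | hts
        · rw [uIoc_of_le hts] at hr
          rw [abs_of_nonneg (by linarith [hr.1]), abs_of_nonneg (by linarith)]; linarith [hr.2]
        · rw [uIoc_of_ge hts] at hr
          rw [abs_of_nonpos (by linarith [hr.2]), abs_of_nonpos (by linarith)]; linarith [hr.1]
      calc ‖∫ r in t..s, (S.act r.toNNReal Lψt x - S.act b Lψt x)‖ ≤ C_D * |s - t| * |s - t| :=
            norm_integral_le_of_norm_le_const h3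
        _ = C_D * (s - t) ^ 2 := by rw [mul_assoc, abs_mul_abs_self]; ring
    -- the algebraic decomposition
    have hsplit : S.act a (fun y => Ψ (s, y)) x - S.act b ψt x -
        (s - t) * S.act b (fun y => dψt y + Lψt y) x =
        (∫ y, (Ψ (s, y) - ψt y - (s - t) * dψt y) ∂(S.kernel a x)) +
          (s - t) * (S.act a dψt x - S.act b dψt x) +
          (S.act a ψt x - S.act b ψt x - (s - t) * S.act b Lψt x) := by
      have i1 : Integrable (fun y => Ψ (s, y) - ψt y) (S.kernel a x) := iψs.sub (iψt a)
      have i2 : Integrable (fun y => (s - t) * dψt y) (S.kernel a x) := (idψt a).const_mul _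
      have i3 : Integrable (fun y => dψt y + Lψt y) (S.kernel b x) := (idψt b).add (iLψt b)
      simp only [act_apply]
      rw [integral_sub i1 i2, integral_sub iψs (iψt a), MeasureTheory.integral_const_mul,
        integral_add (idψt b) (iLψt b)]
      ring
    rw [hsplit]
    refine (abs_add_three _ _ _).trans ?_
    rw [hK]
    linarith [hA, hB, hD]
  -- conclusion: `o(s - t)`
  rw [hasDerivAt_iff_isLittleO]
  have hbig : (fun s : ℝ => S.act s.toNNReal (fun y => Ψ (s, y)) x - S.act t.toNNReal (fun y => Ψ (t, y)) x -
      (s - t) • S.act t.toNNReal (fun y => fderiv ℝ Ψ (t, y) (1, 0) + L (fun y' => Ψ (t, y')) y) x) =O[𝓝 t]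
      fun s : ℝ => ‖s - t‖ ^ 2 := by
    refine IsBigO.of_bound K ?_
    filter_upwards [Ioi_mem_nhds ht] with s hs
    rw [Real.norm_eq_abs, smul_eq_mul, Real.norm_of_nonneg (by positivity), Real.norm_eq_abs, sq_abs]
    exact hkey s hs
  exact hbig.trans_isLittleO (isLittleO_pow_sub_sub t one_lt_two)

/-- **The orbit of a smooth family is Lipschitz in time on `(0, ∞)`**:
`|∫ g(s,·) dP_s - ∫ g(t,·) dP_t| ≤ (M₁ + C)|s - t|` for `g ∈ C_c^∞(ℝ × X)`, `s, t > 0`. [folklore] -/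
theorem abs_act_family_sub_le {g : ℝ × X → ℝ} (hg : ContDiff ℝ ∞ g) (hgc : HasCompactSupport g)
    (x : X) : ∃ K : ℝ, ∀ s t : ℝ, 0 < s → 0 < t →
      |S.act s.toNNReal (fun y => g (s, y)) x - S.act t.toNNReal (fun y => g (t, y)) x| ≤ K * |s - t| := by
  obtain ⟨hLgs, hLgc⟩ := hL g hg hgc
  obtain ⟨M₁, hM₁0, hM₁⟩ := exists_bound_of_hasCompactSupport' (contDiff_timeDeriv hg).continuous
    (hasCompactSupport_timeDeriv hgc)
  obtain ⟨C, hC0, hC⟩ := exists_bound_of_hasCompactSupport' hLgs.continuous hLgc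
  obtain ⟨Cg, -, hCg⟩ := exists_bound_of_hasCompactSupport' hg.continuous hgc
  refine ⟨M₁ + C, fun s t hs ht => ?_⟩
  set a : ℝ≥0 := s.toNNReal
  set b : ℝ≥0 := t.toNNReal
  have hac : ((a : ℝ≥0) : ℝ) = s := Real.coe_toNNReal _ hs.le
  have hbc : ((b : ℝ≥0) : ℝ) = t := Real.coe_toNNReal _ ht.le
  have igs : Integrable (fun y => g (s, y)) (S.kernel a x) :=
    S.integrable_kernel_of_norm_le a x (contDiff_spaceSlice hg s).continuous fun y => hCg (s, y)
  have igt : Integrable (fun y => g (t, y)) (S.kernel a x) :=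
    S.integrable_kernel_of_norm_le a x (contDiff_spaceSlice hg t).continuous fun y => hCg (t, y)
  have h1 : |S.act a (fun y => g (s, y)) x - S.act a (fun y => g (t, y)) x| ≤ M₁ * |s - t| := by
    simp only [act_apply]
    rw [← integral_sub igs igt, ← Real.norm_eq_abs]
    calc ‖∫ y, (g (s, y) - g (t, y)) ∂(S.kernel a x)‖ ≤ M₁ * |s - t| * (S.kernel a x).real univ :=
          norm_integral_le_of_norm_le_const (Eventually.of_forall fun y => by
            rw [Real.norm_eq_abs]; exact abs_sub_timeSlice_le hg hM₁ s t y)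
      _ = M₁ * |s - t| := by simp
  have h2 : |S.act a (fun y => g (t, y)) x - S.act b (fun y => g (t, y)) x| ≤ C * |s - t| := by
    have h := S.abs_act_sub_act_le (contDiff_spaceSlice hg t) (hasCompactSupport_spaceSlice hgc t)
      (hLgs.continuous.comp (Continuous.prodMk_right t)) (fun y => hC (t, y)) a b x
    rwa [hac, hbc] at h
  calc |S.act a (fun y => g (s, y)) x - S.act b (fun y => g (t, y)) x|
      ≤ |S.act a (fun y => g (s, y)) x - S.act a (fun y => g (t, y)) x| +
          |S.act a (fun y => g (t, y)) x - S.act b (fun y => g (t, y)) x| := abs_sub_le _ _ _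
    _ ≤ M₁ * |s - t| + C * |s - t| := add_le_add h1 h2
    _ = (M₁ + C) * |s - t| := by ring

/-- The orbit of a smooth family is continuous on `(0, ∞)`. [folklore] -/
theorem continuousOn_act_family {g : ℝ × X → ℝ} (hg : ContDiff ℝ ∞ g) (hgc : HasCompactSupport g)
    (x : X) : ContinuousOn (fun s : ℝ => S.act s.toNNReal (fun y => g (s, y)) x) (Ioi 0) := by
  obtain ⟨K, hK⟩ := S.abs_act_family_sub_le hL hg hgc x
  refine Metric.continuousOn_iff.2 fun t ht ε hε => ⟨ε / (|K| + 1), by positivity, fun s hs hst => ?_⟩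
  rw [Real.dist_eq] at hst ⊢
  calc |S.act s.toNNReal (fun y => g (s, y)) x - S.act t.toNNReal (fun y => g (t, y)) x|
      ≤ K * |s - t| := hK s t hs ht
    _ ≤ |K| * |s - t| := mul_le_mul_of_nonneg_right (le_abs_self K) (abs_nonneg _)
    _ ≤ |K| * (ε / (|K| + 1)) := mul_le_mul_of_nonneg_left hst.le (abs_nonneg K)
    _ = ε * (|K| / (|K| + 1)) := by ring
    _ < ε := mul_lt_of_lt_one_right hε ((div_lt_one (by positivity)).2 (by linarith))

/-- **The Kolmogorov forward (Fokker–Planck) equation in distributional form.** For every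
`S : MarkovSemigroupFor L` with `L` acting smoothly on smooth compactly supported families, every
starting point `x`, and every test function `Ψ ∈ C_c^∞(ℝ × X)` supported in `(0, ∞) × X`:
`∫_0^∞ ∫ (∂_tΨ(t, y) + L(Ψ(t, ·))(y)) P_t(x, dy) dt = 0` — i.e. the space-time law
`dt P_t(x, dy)` of the process started at `x` solves `(∂_t - L_y)^* u = 0` in `𝓓'((0,∞) × X)`
(§4: the `C^∞` law "is a consequence of Hörmander Theorem" applied to this equation).
[cite: ReyBelletThomas2002, §4] -/
theorem forwardEquation {Ψ : ℝ × X → ℝ} (hΨ : ContDiff ℝ ∞ Ψ) (hΨc : HasCompactSupport Ψ)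
    (hΨ0 : tsupport Ψ ⊆ Set.Ioi (0 : ℝ) ×ˢ Set.univ) (x : X) :
    ∫ t in Set.Ioi (0 : ℝ),
      S.act t.toNNReal (fun y => fderiv ℝ Ψ (t, y) (1, 0) + L (fun y' => Ψ (t, y')) y) x = 0 := by
  set F : ℝ → ℝ := fun s => S.act s.toNNReal (fun y => Ψ (s, y)) x with hF
  set G : ℝ → ℝ := fun s =>
    S.act s.toNNReal (fun y => fderiv ℝ Ψ (s, y) (1, 0) + L (fun y' => Ψ (s, y')) y) x with hG
  -- the time support of `Ψ` lies in `[δ, T]` with `δ > 0`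
  have hKc : IsCompact (tsupport Ψ) := hΨc
  obtain ⟨δ, hδ0, hδ⟩ : ∃ δ : ℝ, 0 < δ ∧ ∀ p ∈ tsupport Ψ, δ < p.1 := by
    rcases (tsupport Ψ).eq_empty_or_nonempty with he | hne
    · exact ⟨1, one_pos, fun p hp => by simp [he] at hp⟩
    · obtain ⟨p₀, hp₀, hmin⟩ := hKc.exists_isMinOn hne continuous_fst.continuousOn
      have h0 : 0 < p₀.1 := (hΨ0 hp₀).1
      exact ⟨p₀.1 / 2, by positivity, fun p hp => by have := hmin hp; simp at this; linarith⟩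
  obtain ⟨T, hT⟩ := (hKc.image continuous_fst).bddAbove
  have hT' : ∀ p ∈ tsupport Ψ, p.1 ≤ T := fun p hp => hT ⟨p, hp, rfl⟩
  set T₁ : ℝ := max T δ + 1 with hT₁
  have hδT : δ ≤ T₁ := by rw [hT₁]; linarith [le_max_right T δ]
  -- outside `(δ, T₁)` everything vanishes
  have hout : ∀ t : ℝ, (t ≤ δ ∨ T₁ ≤ t) → ∀ y, (t, y) ∉ tsupport Ψ := by
    intro t ht y hmem
    rcases ht with ht | ht
    · exact absurd (hδ _ hmem) (not_lt.2 ht)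
    · have := hT' _ hmem
      simp only at this
      rw [hT₁] at ht
      linarith [le_max_left T δ]
  have hΨout : ∀ t : ℝ, (t ≤ δ ∨ T₁ ≤ t) → (fun y => Ψ (t, y)) = fun _ => 0 := fun t ht =>
    funext fun y => image_eq_zero_of_notMem_tsupport (hout t ht y)
  have hdΨout : ∀ t : ℝ, (t ≤ δ ∨ T₁ ≤ t) → ∀ y, fderiv ℝ Ψ (t, y) (1, 0) = 0 := fun t ht y => by
    rw [Function.notMem_support.1 fun hmem => hout t ht y (support_fderiv_subset ℝ hmem)]
    rfl
  have hL0 : ∀ y, L (fun _ => (0 : ℝ)) y = 0 := apply_zero_eq_zero hL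
  have hGout : ∀ t : ℝ, (t ≤ δ ∨ T₁ ≤ t) → G t = 0 := by
    intro t ht
    simp only [hG, hΨout t ht, hdΨout t ht, hL0, add_zero]
    simp [act_apply]
  have hFout : ∀ t : ℝ, (t ≤ δ ∨ T₁ ≤ t) → F t = 0 := by
    intro t ht
    simp only [hF, hΨout t ht]
    simp [act_apply]
  -- FTC on `[δ, T₁]`
  have hderiv : ∀ t ∈ uIcc δ T₁, HasDerivAt F (G t) t := fun t ht => by
    rw [uIcc_of_le hδT] at ht
    exact S.hasDerivAt_act_family hL hΨ hΨc x (hδ0.trans_le ht.1)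
  have hg : ContDiff ℝ ∞ fun p : ℝ × X => fderiv ℝ Ψ p (1, 0) + L (fun y' => Ψ (p.1, y')) p.2 :=
    (contDiff_timeDeriv hΨ).add (hL Ψ hΨ hΨc).1
  have hgc : HasCompactSupport fun p : ℝ × X => fderiv ℝ Ψ p (1, 0) + L (fun y' => Ψ (p.1, y')) p.2 :=
    (hasCompactSupport_timeDeriv hΨc).add (hL Ψ hΨ hΨc).2
  have hGcont : ContinuousOn G (Ioi 0) := S.continuousOn_act_family hL hg hgc x
  have hint : IntervalIntegrable G volume δ T₁ :=
    (hGcont.mono (by rw [uIcc_of_le hδT]; exact fun t ht => hδ0.trans_le ht.1)).intervalIntegrable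
  have hFTC := integral_eq_sub_of_hasDerivAt hderiv hint
  rw [hFout δ (Or.inl le_rfl), hFout T₁ (Or.inr le_rfl), sub_zero] at hFTC
  -- `∫_{(0,∞)} G = ∫_δ^{T₁} G = 0`
  have hsub : Ioc δ T₁ ⊆ Ioi (0 : ℝ) := fun t ht => hδ0.trans ht.1
  rw [setIntegral_eq_of_subset_of_forall_sdiff_eq_zero measurableSet_Ioi hsub fun t ht => ?_,
    ← intervalIntegral.integral_of_le hδT]
  · exact hFTC
  · have ht2 : ¬ (δ < t ∧ t ≤ T₁) := ht.2
    rw [not_and_or, not_lt, not_le] at ht2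
    rcases ht2 with h | h
    · exact hGout t (Or.inl h)
    · exact hGout t (Or.inr h.le)

end MarkovSemigroupFor

end Literature.MathematicalPhysics.KineticTheory.HeatConduction
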